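import Literature.NumberTheory.Sieve.IwaniecAlmostPrimesPairSums
import HarnessLib

/-!
# Iwaniec (1978), §4: the dispersion `T(n₁, n₂)` of one pair — PROVED

H. Iwaniec, *Almost-primes represented by quadratic polynomials*, Invent. Math. 47 (1978)
171–188, §4 pp. 181–185.

For one pair `(n₁, n₂)` of squarefree moduli the dispersion summand
`T(n₁, n₂) = W − x e₂ V(n₁) − x e₁ V(n₂) + x² e₁ e₂ U` (`tsum2`, `IwaniecAlmostPrimesDispersion`)
is bounded by combining the two-sided evaluations of `W`, `V` (`IwaniecAlmostPrimesVW`) and `U`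
(`usum_linear`) with the arithmetic of the `W` main term (`abs_rho_gsum_sub_le`): the main terms
`e₁ e₂ κ ∑_m [(X/m)² − 2 x (X/m)/m + x²/m²]` cancel up to `e₁ e₂ κ ∑_m O(d · X/m)` ("completing the
square", `|⌊x⌋/m − x/m| ≤ 1`), leaving (`abs_tsum2_le`)
`|T(n₁, n₂)| ≤ |κ| · pairRes + pairErr`, where `pairRes = e₁ e₂ ∑_{A'<m≤B₀} ((d+2)(⌊X/m⌋+1) + 2x/m)`
and `pairErr` collects the Lemma-4 errors of `W`, `V(n₁)`, `V(n₂)` and the error of `U`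
(p. 184: "the main terms … cancel out and we are left with the error terms").
-/

noncomputable section

open Finset Real

namespace Literature.NumberTheory.Sieve.Iwaniec1978

/-! ### Completing the square -/

/-- `0 ≤ x/m − ⌊⌊x⌋/m⌋ < 1`. [folklore] -/
theorem natFloor_div_sub {x : ℝ} (hx : 0 ≤ x) {m : ℕ} (hm : 0 < m) :
    0 ≤ x / m - ((⌊x⌋₊ / m : ℕ) : ℝ) ∧ x / m - ((⌊x⌋₊ / m : ℕ) : ℝ) < 1 := by
  rw [← Nat.floor_div_natCast]
  have h0 : 0 ≤ x / m := by positivity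
  exact ⟨sub_nonneg.mpr (Nat.floor_le h0), by linarith [Nat.lt_floor_add_one (x / m)]⟩

/-- The per-`m` bracket of the upper sandwich: if `|P − e(L+1)²| ≤ e d (L+1)` and `|L − a| ≤ 1`
then `|P − 2aeL + ea²| ≤ e (d+2)(L+1)`. [folklore] -/
theorem bracket_plus_le {P e d L a : ℝ} (he : 0 ≤ e) (hd : 0 ≤ d) (hL : 0 ≤ L)
    (hP : |P - e * (L + 1) ^ 2| ≤ e * d * (L + 1)) (ha : |L - a| ≤ 1) :
    |P - 2 * a * e * L + e * a ^ 2| ≤ e * ((d + 2) * (L + 1)) := by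
  obtain ⟨hP1, hP2⟩ := abs_le.mp hP
  obtain ⟨ha1, ha2⟩ := abs_le.mp ha
  have hsq : (L - a) ^ 2 ≤ 1 := by nlinarith
  have h1 : e * (L - a) ^ 2 ≤ e * 1 := mul_le_mul_of_nonneg_left hsq he
  have h2 : 0 ≤ e * (L - a) ^ 2 := mul_nonneg he (sq_nonneg _)
  have hid : P - 2 * a * e * L + e * a ^ 2 =
      (P - e * (L + 1) ^ 2) + e * (L - a) ^ 2 + e * (2 * L + 1) := by ring
  have hid2 : e * ((d + 2) * (L + 1)) = e * d * (L + 1) + e * 1 + e * (2 * L + 1) := by ring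
  have hedL : 0 ≤ e * d * (L + 1) := by positivity
  have heL : 0 ≤ e * (2 * L + 1) := by positivity
  rw [hid, hid2, abs_le]
  constructor <;> linarith

/-- The per-`m` bracket of the lower sandwich: if `|P − eL²| ≤ e d L` and `|L − a| ≤ 1`, `a ≥ 0`,
then `|P − 2ae(L+1) + ea²| ≤ e ((d+2)(L+1) + 2a)`. [folklore] -/
theorem bracket_minus_le {P e d L a : ℝ} (he : 0 ≤ e) (hd : 0 ≤ d) (hL : 0 ≤ L) (ha0 : 0 ≤ a)
    (hP : |P - e * L ^ 2| ≤ e * d * L) (ha : |L - a| ≤ 1) :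
    |P - 2 * a * e * (L + 1) + e * a ^ 2| ≤ e * ((d + 2) * (L + 1) + 2 * a) := by
  obtain ⟨hP1, hP2⟩ := abs_le.mp hP
  obtain ⟨ha1, ha2⟩ := abs_le.mp ha
  have hsq : (L - a) ^ 2 ≤ 1 := by nlinarith
  have h1 : e * (L - a) ^ 2 ≤ e * 1 := mul_le_mul_of_nonneg_left hsq he
  have h2 : 0 ≤ e * (L - a) ^ 2 := mul_nonneg he (sq_nonneg _)
  have hid : P - 2 * a * e * (L + 1) + e * a ^ 2 =
      (P - e * L ^ 2) + e * (L - a) ^ 2 - e * (2 * a) := by ring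
  have hid2 : e * ((d + 2) * (L + 1) + 2 * a) =
      e * d * L + e * d + e * 1 + e * (2 * L + 1) + e * (2 * a) := by ring
  have hedL : 0 ≤ e * d * L := by positivity
  have hed : 0 ≤ e * d := by positivity
  have heL : 0 ≤ e * (2 * L + 1) := by positivity
  have hea : 0 ≤ e * (2 * a) := by positivity
  rw [hid, hid2, abs_le]
  constructor <;> linarith

/-- From two-sided sandwiches to an absolute bound: if `T ≤ κ B⁺ + Err`, `κ B⁻ − Err ≤ T` and
`|B⁺|, |B⁻| ≤ R` then `|T| ≤ |κ| R + Err`. [folklore] -/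
theorem abs_le_of_sandwich {T κ Bp Bm R Err : ℝ} (hup : T ≤ κ * Bp + Err) (hlo : κ * Bm - Err ≤ T)
    (hBp : |Bp| ≤ R) (hBm : |Bm| ≤ R) : |T| ≤ |κ| * R + Err := by
  have h1 : κ * Bp ≤ |κ| * R := by
    calc κ * Bp ≤ |κ * Bp| := le_abs_self _
      _ = |κ| * |Bp| := abs_mul _ _
      _ ≤ |κ| * R := mul_le_mul_of_nonneg_left hBp (abs_nonneg _)
  have h2 : -(|κ| * R) ≤ κ * Bm := by
    calc -(|κ| * R) ≤ -(|κ| * |Bm|) := by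
          have := mul_le_mul_of_nonneg_left hBm (abs_nonneg κ); linarith
      _ = -|κ * Bm| := by rw [abs_mul]
      _ ≤ κ * Bm := neg_abs_le _
  rw [abs_le]; constructor <;> linarith

/-! ### The bound for one pair -/

/-- The residual of the main-term cancellation for the pair `(n₁, n₂)`:
`e₁ e₂ ∑_{A'<m≤B₀} ((d+2)(⌊⌊x⌋/m⌋+1) + 2x/m)`. [cite: IwaniecInventiones1978, §4 p. 184] -/
def pairRes (x : ℝ) (A' B₀ n₁ n₂ : ℕ) : ℝ :=
  (rho n₁ : ℝ) / n₁ * ((rho n₂ : ℝ) / n₂) *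
    ∑ m ∈ Finset.Ioc A' B₀, (((Nat.gcd n₁ n₂ : ℝ) + 2) * (((⌊x⌋₊ / m : ℕ) : ℝ) + 1) + 2 * (x / m))

/-- The error terms for the pair `(n₁, n₂)`: `(L+1)² τ(d) wErr + x e₂ (L+1) Err_V(n₁)/(A'+1)
+ x e₁ (L+1) Err_V(n₂)/(A'+1) + x² e₁ e₂ Err_U`, `L = ⌊⌊x⌋/(A'+1)⌋`.
[cite: IwaniecInventiones1978, §4 p. 184] -/
def pairErr (CV CW ε x : ℝ) (A' B₀ E n₁ n₂ : ℕ) : ℝ :=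
  (((⌊x⌋₊ / (A' + 1) + 1 : ℕ) : ℝ)) ^ 2 *
      (((Nat.gcd n₁ n₂).divisors.card : ℝ) * wErr CW ε (Nat.lcm n₁ n₂) (Nat.gcd n₁ n₂) A' B₀ E) +
    x * ((rho n₂ : ℝ) / n₂) * ((((⌊x⌋₊ / (A' + 1) + 1 : ℕ) : ℝ)) *
      windowErr CV ε n₁ (Nat.lcm n₁ n₂) 1 0 A' B₀ E / (A' + 1)) +
    x * ((rho n₁ : ℝ) / n₁) * ((((⌊x⌋₊ / (A' + 1) + 1 : ℕ) : ℝ)) *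
      windowErr CV ε n₂ (Nat.lcm n₁ n₂) 1 0 A' B₀ E / (A' + 1)) +
    x ^ 2 * ((rho n₁ : ℝ) / n₁) * ((rho n₂ : ℝ) / n₂) *
      (2 * ((2 * (Nat.lcm n₁ n₂).divisors.card + 7) * (Real.sqrt B₀ * Real.sqrt E + B₀ / E)) /
        ((A' : ℝ) + 1) ^ 2)

/-- **The dispersion summand of one pair** (pp. 181–184): for squarefree `n₁, n₂`, `x ≥ 0`,
`2 ≤ A' ≤ B₀`, `1 ≤ E ≤ A'`, `⌊√B₀⌋ ≤ G`,
`|T(n₁, n₂)| ≤ |κ([n₁,n₂], G, E)| · pairRes + pairErr`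
(the main terms of `W`, `2xV`, `x²U` cancel: `(⌊x/m⌋+θ)² − 2x(⌊x/m⌋+θ')/m + x²/m² = O(1 + x/m)`).
[cite: IwaniecInventiones1978, §4 p. 184] -/
theorem abs_tsum2_le (h6 : lemma6_hooley) {ε : ℝ} (hε : 0 < ε) :
    ∃ CV CW : ℝ, 0 ≤ CV ∧ 0 ≤ CW ∧ ∀ (x : ℝ) (A' B₀ E G n₁ n₂ : ℕ), 0 ≤ x →
      Squarefree n₁ → Squarefree n₂ → 2 ≤ A' → A' ≤ B₀ → 1 ≤ E → E ≤ A' → Nat.sqrt B₀ ≤ G →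
      |tsum2 x (Finset.Ioc A' B₀) n₁ n₂| ≤
        |kappa (Nat.lcm n₁ n₂) G E| * pairRes x A' B₀ n₁ n₂ + pairErr CV CW ε x A' B₀ E n₁ n₂ := by
  obtain ⟨CV, hCV0, hV⟩ := vsum_bounds h6 hε
  obtain ⟨CW, hCW0, hW⟩ := wsum_bounds h6 hε
  refine ⟨CV, CW, hCV0, hCW0, ?_⟩
  intro x A' B₀ E G n₁ n₂ hx hn₁ hn₂ hA hAB hE hEA hG
  have hn₁0 : n₁ ≠ 0 := hn₁.ne_zero
  have hn₂0 : n₂ ≠ 0 := hn₂.ne_zero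
  -- the three evaluations and the `W` main term, in raw form
  have hqsf : Squarefree (Nat.lcm n₁ n₂) := by
    obtain ⟨hcop, hlcm⟩ := coprime_div_gcd_of_squarefree hn₂ hn₁0
    rw [hlcm, Nat.squarefree_mul_iff]
    exact ⟨hcop, hn₁, hn₂.squarefree_of_dvd (Nat.div_dvd_of_dvd (Nat.gcd_dvd_right _ _))⟩
  have hWb := hW ⌊x⌋₊ n₁ n₂ A' B₀ E G hn₁ hn₂ hA hE hEA hG
  have hV₁b := hV ⌊x⌋₊ n₁ (Nat.lcm n₁ n₂) A' B₀ E G hqsf (Nat.dvd_lcm_left _ _) hA hAB hE hEA hG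
  have hV₂b := hV ⌊x⌋₊ n₂ (Nat.lcm n₁ n₂) A' B₀ E G hqsf (Nat.dvd_lcm_right _ _) hA hAB hE hEA hG
  have hUb := usum_linear (Q := Nat.lcm n₁ n₂) hqsf hAB hE hEA hG
  have hT := tsum2_eq x (Finset.Ioc A' B₀) n₁ n₂
  have hG' : ∀ L : ℕ, |(rho (Nat.lcm n₁ n₂) : ℝ) / Nat.lcm n₁ n₂ *
        ∑ l₁ ∈ Finset.range L, ∑ l₂ ∈ Finset.range L, gfun (Nat.gcd n₁ n₂) l₁ l₂ -
      (rho n₁ : ℝ) / n₁ * ((rho n₂ : ℝ) / n₂) * (L : ℝ) ^ 2| ≤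
      (rho n₁ : ℝ) / n₁ * ((rho n₂ : ℝ) / n₂) * Nat.gcd n₁ n₂ * L :=
    fun L => abs_rho_gsum_sub_le hn₁ hn₂ L
  unfold pairRes pairErr
  -- abbreviations
  set X := ⌊x⌋₊ with hX
  set q := Nat.lcm n₁ n₂ with hq
  set d := Nat.gcd n₁ n₂ with hd
  set e₁ : ℝ := (rho n₁ : ℝ) / n₁ with he₁
  set e₂ : ℝ := (rho n₂ : ℝ) / n₂ with he₂
  set κ : ℝ := kappa q G E with hκ
  set cW : ℝ := (rho q : ℝ) / q with hcW
  set I := Finset.Ioc A' B₀ with hI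
  set Msf := I.filter (fun m : ℕ => n₁.Coprime m ∧ n₂.Coprime m) with hMsf
  set Lx : ℕ := X / (A' + 1) with hLx
  set EW : ℝ := (((Lx + 1 : ℕ) : ℝ)) ^ 2 * ((d.divisors.card : ℝ) * wErr CW ε q d A' B₀ E) with hEW
  set EV₁ : ℝ := (((Lx + 1 : ℕ) : ℝ)) * windowErr CV ε n₁ q 1 0 A' B₀ E / (A' + 1) with hEV₁
  set EV₂ : ℝ := (((Lx + 1 : ℕ) : ℝ)) * windowErr CV ε n₂ q 1 0 A' B₀ E / (A' + 1) with hEV₂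
  set EU : ℝ := 2 * ((2 * q.divisors.card + 7) * (Real.sqrt B₀ * Real.sqrt E + B₀ / E)) /
    ((A' : ℝ) + 1) ^ 2 with hEU
  set SWp : ℝ := ∑ m ∈ I, ∑ l₁ ∈ Finset.range (X / m + 1), ∑ l₂ ∈ Finset.range (X / m + 1),
    gfun d l₁ l₂ with hSWp
  set SWm : ℝ := ∑ m ∈ I, ∑ l₁ ∈ Finset.range (X / m), ∑ l₂ ∈ Finset.range (X / m),
    gfun d l₁ l₂ with hSWm
  set SVp : ℝ := ∑ m ∈ I, (((X / m + 1 : ℕ) : ℝ)) / m with hSVp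
  set SVm : ℝ := ∑ m ∈ I, (((X / m : ℕ) : ℝ)) / m with hSVm
  set SU : ℝ := ∑ m ∈ I, (1 : ℝ) / (m : ℝ) ^ 2 with hSU
  clear_value X q d e₁ e₂ κ cW I Msf Lx EW EV₁ EV₂ EU SWp SWm SVp SVm SU
  -- identify the `m`-sets
  have hMsfQ : I.filter (fun m : ℕ => m.Coprime q) = Msf := by
    rw [hMsf]
    refine Finset.filter_congr fun m _ => ?_
    rw [hq, coprime_lcm_iff]
    exact Iff.and Nat.coprime_comm Nat.coprime_comm
  rw [hMsfQ] at hV₁b hV₂b hUb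
  have hU : usum Msf = ∑ m ∈ Msf, (rho m : ℝ) / (m : ℝ) ^ 2 := rfl
  rw [← hU] at hUb
  obtain ⟨hWup, hWlo⟩ := hWb
  obtain ⟨hV₁up, hV₁lo⟩ := hV₁b
  obtain ⟨hV₂up, hV₂lo⟩ := hV₂b
  obtain ⟨hUlo, hUup⟩ := abs_le.mp hUb
  have he₁0 : 0 ≤ e₁ := by rw [he₁]; positivity
  have he₂0 : 0 ≤ e₂ := by rw [he₂]; positivity
  have hxe₁ : 0 ≤ x * e₁ := mul_nonneg hx he₁0
  have hxe₂ : 0 ≤ x * e₂ := mul_nonneg hx he₂0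
  have hx2e : 0 ≤ x ^ 2 * e₁ * e₂ := by positivity
  -- upper and lower sandwiches for `T`
  have hTup : tsum2 x I n₁ n₂ ≤
      κ * (cW * SWp - 2 * x * (e₁ * e₂) * SVm + x ^ 2 * (e₁ * e₂) * SU) +
        (EW + x * e₂ * EV₁ + x * e₁ * EV₂ + x ^ 2 * e₁ * e₂ * EU) := by
    have h1 := mul_le_mul_of_nonneg_left hV₁lo hxe₂
    have h2 := mul_le_mul_of_nonneg_left hV₂lo hxe₁
    have h3 : x ^ 2 * e₁ * e₂ * usum Msf ≤ x ^ 2 * e₁ * e₂ * (κ * SU + EU) :=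
      mul_le_mul_of_nonneg_left (by linarith) hx2e
    have key : κ * (cW * SWp - 2 * x * (e₁ * e₂) * SVm + x ^ 2 * (e₁ * e₂) * SU) +
        (EW + x * e₂ * EV₁ + x * e₁ * EV₂ + x ^ 2 * e₁ * e₂ * EU) =
        (cW * κ * SWp + EW) - x * e₂ * (e₁ * κ * SVm - EV₁) - x * e₁ * (e₂ * κ * SVm - EV₂) +
          x ^ 2 * e₁ * e₂ * (κ * SU + EU) := by ring
    rw [hT]
    linarith [hWup, h1, h2, h3, key]
  have hTlo : κ * (cW * SWm - 2 * x * (e₁ * e₂) * SVp + x ^ 2 * (e₁ * e₂) * SU) -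
        (EW + x * e₂ * EV₁ + x * e₁ * EV₂ + x ^ 2 * e₁ * e₂ * EU) ≤ tsum2 x I n₁ n₂ := by
    have h1 := mul_le_mul_of_nonneg_left hV₁up hxe₂
    have h2 := mul_le_mul_of_nonneg_left hV₂up hxe₁
    have h3 : x ^ 2 * e₁ * e₂ * (κ * SU - EU) ≤ x ^ 2 * e₁ * e₂ * usum Msf :=
      mul_le_mul_of_nonneg_left (by linarith) hx2e
    have key : κ * (cW * SWm - 2 * x * (e₁ * e₂) * SVp + x ^ 2 * (e₁ * e₂) * SU) -
        (EW + x * e₂ * EV₁ + x * e₁ * EV₂ + x ^ 2 * e₁ * e₂ * EU) =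
        (cW * κ * SWm - EW) - x * e₂ * (e₁ * κ * SVp + EV₁) - x * e₁ * (e₂ * κ * SVp + EV₂) +
          x ^ 2 * e₁ * e₂ * (κ * SU - EU) := by ring
    rw [hT]
    linarith [hWlo, h1, h2, h3, key]
  -- the brackets
  have hIpos : ∀ m ∈ I, 0 < m := by
    intro m hm; rw [hI, Finset.mem_Ioc] at hm; omega
  have he0 : 0 ≤ e₁ * e₂ := mul_nonneg he₁0 he₂0
  have hBp : |cW * SWp - 2 * x * (e₁ * e₂) * SVm + x ^ 2 * (e₁ * e₂) * SU| ≤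
      e₁ * e₂ * ∑ m ∈ I, (((d : ℝ) + 2) * (((X / m : ℕ) : ℝ) + 1) + 2 * (x / m)) := by
    have hsum : cW * SWp - 2 * x * (e₁ * e₂) * SVm + x ^ 2 * (e₁ * e₂) * SU =
        ∑ m ∈ I, (cW * ∑ l₁ ∈ Finset.range (X / m + 1), ∑ l₂ ∈ Finset.range (X / m + 1),
            gfun d l₁ l₂ - 2 * (x / m) * (e₁ * e₂) * (((X / m : ℕ) : ℝ)) +
          (e₁ * e₂) * (x / m) ^ 2) := by
      rw [hSWp, hSVm, hSU]
      simp only [Finset.mul_sum]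
      rw [← Finset.sum_sub_distrib, ← Finset.sum_add_distrib]
      refine Finset.sum_congr rfl fun m hm => ?_
      have hm0 : (m : ℝ) ≠ 0 := by exact_mod_cast (hIpos m hm).ne'
      field_simp
    rw [hsum, Finset.mul_sum]
    refine (Finset.abs_sum_le_sum_abs _ _).trans (Finset.sum_le_sum fun m hm => ?_)
    have hm := hIpos m hm
    have hfl := natFloor_div_sub hx hm
    rw [← hX] at hfl
    have hP := hG' (X / m + 1)
    push_cast at hP
    have ha : |(((X / m : ℕ) : ℝ)) - x / m| ≤ 1 := by
      rw [abs_le]; constructor <;> linarith [hfl.1, hfl.2]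
    have h := bracket_plus_le he0 (Nat.cast_nonneg d) (Nat.cast_nonneg (X / m)) hP ha
    refine h.trans ?_
    apply mul_le_mul_of_nonneg_left _ he0
    have : 0 ≤ 2 * (x / m) := by positivity
    linarith
  have hBm : |cW * SWm - 2 * x * (e₁ * e₂) * SVp + x ^ 2 * (e₁ * e₂) * SU| ≤
      e₁ * e₂ * ∑ m ∈ I, (((d : ℝ) + 2) * (((X / m : ℕ) : ℝ) + 1) + 2 * (x / m)) := by
    have hsum : cW * SWm - 2 * x * (e₁ * e₂) * SVp + x ^ 2 * (e₁ * e₂) * SU =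
        ∑ m ∈ I, (cW * ∑ l₁ ∈ Finset.range (X / m), ∑ l₂ ∈ Finset.range (X / m),
            gfun d l₁ l₂ - 2 * (x / m) * (e₁ * e₂) * ((((X / m : ℕ) : ℝ)) + 1) +
          (e₁ * e₂) * (x / m) ^ 2) := by
      rw [hSWm, hSVp, hSU]
      simp only [Finset.mul_sum]
      rw [← Finset.sum_sub_distrib, ← Finset.sum_add_distrib]
      refine Finset.sum_congr rfl fun m hm => ?_
      have hm0 : (m : ℝ) ≠ 0 := by exact_mod_cast (hIpos m hm).ne'
      push_cast
      field_simp
    rw [hsum, Finset.mul_sum]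
    refine (Finset.abs_sum_le_sum_abs _ _).trans (Finset.sum_le_sum fun m hm => ?_)
    have hm := hIpos m hm
    have hfl := natFloor_div_sub hx hm
    rw [← hX] at hfl
    have hP := hG' (X / m)
    have ha : |(((X / m : ℕ) : ℝ)) - x / m| ≤ 1 := by
      rw [abs_le]; constructor <;> linarith [hfl.1, hfl.2]
    have hxm : 0 ≤ x / m := by positivity
    exact bracket_minus_le he0 (Nat.cast_nonneg d) (Nat.cast_nonneg (X / m)) hxm hP ha
  -- conclusion
  exact abs_le_of_sandwich hTup hTlo hBp hBm

end Literature.NumberTheory.Sieve.Iwaniec1978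

end
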